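import Literature.MathematicalPhysics.QuantumFieldTheory.BalabanImbrieJaffe1984to88.BIJ88TripleActivity309

/-!
# `BalabanImbrieJaffe1984to88.BIJ88Ineq5144TripleDecayWitness` — T. Bałaban, J. Imbrie, A. Jaffe, *Effective action and cluster properties of the
abelian Higgs model*, Commun. Math. Phys. **114** (1988) 257–315 [BalabanImbrieJaffe1988], Sect. 5.14 (5.14.4) p. 309 [PDF 53] with Sect. 5.13 p. 305–307
[PDF 49–51]: **A KERNEL WITNESS THAT (5.14.4) ON POLYMERS WITH THREE CUBES NEEDS A COVARIANCE-DECAY LETTER AT MODEL LEVEL** — in the §5.13 model of this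
lineage (precision `Δ ≻ 0`, `Δ ≥ m·1`, ANY inter-cube coupling; letters `m, Λ, F, c₀, G, K_Y, K₁, Ĉ`), the located bound (5.14.4) on a THREE-cube chain
is FALSE under the complete regime that PROVES it on the two-cube polymers (p36 g18 `BIJ88Ineq5144TwoCubeChi.ineq5144_locAct_pair_of_struct_chi`,
including the adjusted V-clause).  The flip item of row C2.Eq5.14.3-5.14.4 *"(5.14.4) located for print's COUPLED Δ on |X_β| ≥ 3 (the cluster-expansion
decay)"* therefore cannot be met by ANY volume-uniform clause on the present letters: print's per-cube smallness on long polymers is the decay of the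
covariance chains across `r(e_k)`-cubes (p. 307, verbatim: *"Each time some □_i's are joined, we have s-derivatives, which produce functional derivatives,
chains of covariances C_ω(α), and factors ℱ = O(e^{−cr(e_k)}). … If the walk ω(α) wanders through more than a few cubes, we begin to pickup factors
e^{−cr(e_k)}. These control the sum over walks and partitions, and the factorials, as in [9]."*), which the model must type as a new letter (HOME/GAPS.md
**G-C2-p36-10**; HOME/INTERFACES.md).

statement-level skeleton of published theorems with citation tags; proofs where landed; nothing here is a claim about the Yang–Mills mass gap

PDF held: `paper:balaban1988-cmp114-bij-abelian-higgs-effective-action` (journal page = PDF page + 256); p. 309, verbatim: *"Let us drop the prime, and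
prove that |g₃(H_β, X_β)| ≦ (e^β(L^kε/ε₀)^{1/4−α})^{[|H_β| + β′|X_β∖H_β|]}. (5.14.4) We use X_β∖H_β to denote the set of cubes with no (d/dt)_{γ_j}
factors, j ∈ H_β. The proof of this estimate is similar to the one for g₂."*; p. 307, verbatim: *"Altogether, we typically get at least a small power of
e^β(L^kε/ε₀)^{1/4−α} in every cube of X_α."*

(v1.1 DOC-ONLY: the p. 307 quotation re-read on the x2 render — *"□_i's"* and *"factors ℱ = O(e^{−cr(e_k)})"* (script ℱ), correcting the text layer's «□_j's» / «δF»; owner r16 g23 zero-weight docfix; declarations byte-identical to v1 p350215.)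

WHAT IS PROVED (unit `lit-balaban-p36`, generation 18 of the Phase-2 proof seat p36; HOME/GAPS.md G-C2-p36-10; SKELETON rows C2.Eq5.14.3-5.14.4 /
C2.Eq5.14.5 of `HOME/lit-balaban-r16/ROWS-C2-part2.md`, owner r16 — scopes the flip item, moves no head).
* **`ineq5144_locAct_triple_chiRegime_false`** — see its docstring: the two-cube regime of `BIJ88Ineq5144TwoCubeChi` with `X₂.card = 2 ↦ X₃.card = 3`
  ⊢ `False`, by the chain datum of `BIJ88TripleActivity309` §3 (decorated cube `0`, slot-free cubes `1, 2`; activity = third-order corner sum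
  `⟨·⟩_{012} − ⟨·⟩_{01} − ⟨·⟩_{02} − ⟨·⟩_{12} + ⟨·⟩_{0} + ⟨·⟩_{1} + ⟨·⟩_{2} − ⟨·⟩_∅` of `−Kve^{−Kv}`, `≥ 2·10⁻¹³ > θ³ = 10⁻¹⁵`).
MECHANISM-LEVEL READING (not a claim about the paper): on the chain `□₀–□₁–□₂` decorated only in `□₀`, the third-order mixed difference isolates the
effect of the bond `□₁–□₂` on `□₀`'s marginal THROUGH `□₁` — second order in the couplings, `O(1)` for `O(1)` couplings (site-0 variance `3/4` vs `2/3`);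
the decorated object is worth a fixed power of `θ` under every present letter, so `θ^{β′}` per undecorated cube (here `θ^{2β′}`) is unattainable, and on an
`N`-chain the deficit grows with `N`: a volume-uniform remedy must make the COUPLING CHAIN itself small per cube — print's `e^{−cr(e_k)}`.
HONEST SCOPE: a statement about OUR §5.13 model's letter class; print's (5.14.4) for print's objects is not at issue.  0 `sorry`, 0 definitions, 0 `Prop`
facts (D-0026); imports `BIJ88TripleActivity309` (p36 g18) only — the refuted statement is, binder for binder, that of `BIJ88Ineq5144TwoCubeChi.
ineq5144_locAct_pair_of_struct_chi` (p347595, not imported: nothing of it is used) with `X₂.card = 2 ↦ X₃.card = 3`; modifies nothing.  NOT summit progress; NOT continuum; NOT Clay.  Cell `lit-balaban` Phase 2, seat p36 gen 18 (owner r16, referee ref-5).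
-/

noncomputable section

open Finset MeasureTheory Matrix ProbabilityTheory Filter
open Literature.MathematicalPhysics.QuantumFieldTheory.BalabanImbrieJaffe1984to88
open BIJ88Sect2Statements (pLog)
open BIJ88Sect5Statements (CutoffProfile cutoff)
open BIJ88SlotMoments308 (slotFactor slotFactor_inr)
open BIJ88DirichletForms305 (interpForm)
open BIJ88Clusters5134 (cornerSum)
open BIJ88PolymerRep5134 (IsConn corner)
open BIJ88PolymerRep5134Gauss (ext src)
open BIJ88Eq5145CornerModel (slotB slotY regionLaw isProbabilityMeasure_regionLaw)
open BIJ88Eq5145CornerUrsell (cubeIn)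
open BIJ88W6PrimeVsupp (actIn)
open BIJ88Ineq5144Located (locAct locAct_of_loc)
open BIJ88GaussIntegration309Product (exists_const_all_orders)
open BIJ88CutoffProfileWitness (gevreyCutoff chi1_nonneg)
open BIJ88TripleActivity309

namespace Literature.MathematicalPhysics.QuantumFieldTheory.BalabanImbrieJaffe1984to88.BIJ88Ineq5144TripleDecayWitness

/-! ## (5.14.4) on a three-cube chain FAILS in the §5.13 model under the complete two-cube regime -/
section Main

/-- **NO-GO ON THREE CUBES: (5.14.4) located on a THREE-cube polymer is FALSE in the §5.13 model under the regime that PROVES it on two cubes** — the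
statement of p36 g18 `BIJ88Ineq5144TwoCubeChi.ineq5144_locAct_pair_of_struct_chi` (every binder identical and in the same order: structural data,
`hreg₂`, `hpre₂`, `hvac₂`, print's `e_k ≤ θ`, `2e_k ≤ θ^{β′}`, the adjusted V-clause `K_Y e^{2GK₁} ≤ θ^{1+β′}/2`) with its last binder `X₂.card = 2`
REPLACED by `X₃.card = 3` implies `False`.  Witness: sites = cubes = `Fin 3` with the CHAIN precision `!![2,1,0;1,2,1;0,1,2]` (`m = ½`), `ℱ = 0`, no
χ-slots, ONE interaction term `V(φ) = K e^{−φ₀²}` on cube `0` carrying the one `(d/dt)`, cubes `1, 2` slot-free (`X₃∖H` has TWO cubes, located exponent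
`θ^{1+2β′}`), `t = 1`, `θ = 10⁻⁵`, `β′ = 1`, `K = K₁ = 10⁻¹¹ ≤ θ²/2` (the adjusted V-clause HOLDS), `G = 1`, `Λ = 1`, `c₀ = 10`, `F = 0`,
`e_k = min(10⁻¹³, 1/(16Ĉ))`: every clause holds and the bound demands `≤ θ³ = 10⁻¹⁵`, while by `BIJ88TripleActivity309.actIn_eq_cornerSum` the activity is
the corner sum of `⟨−Kve^{−Kv}⟩` (`v = e^{−φ₀²}`) over the eight laws `1_{Λ′}`, `Λ′ ⊆ {0,1,2}`, whose site-0 Gaussian values are `√(4/10)` (full chain),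
`√(6/14)` (bond 0–1), `√(1/2)` (otherwise): activity `≥ K[(1 − K)(0.6546 + 3·0.7071) − 0.6325 − 3·0.70711] ≥ 2·10⁻¹³`.  READING (HOME/GAPS.md
G-C2-p36-10): the cube TWO bonds away from the decorated cube shifts its marginal at SECOND order in the couplings by an `O(1)` amount (site-0 variance
`3/4` vs `2/3`); with every existing letter the decorated object is worth a FIXED power of `θ`, so no volume-uniform clause on the present letters yields
`θ^{β′}` per undecorated cube — print's per-cube smallness on long polymers is the DECAY of the covariances across `r(e_k)`-cubes (p. 307: *"chains of
covariances C_ω(α) … If the walk ω(α) wanders through more than a few cubes, we begin to pickup factors e^{−cr(e_k)}"*), an input the model does not yet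
carry as a letter. [cite: BalabanImbrieJaffe1988, (5.14.4) p.309; p.307 (Sect. 5.13); p.305–306 (Sect. 5.13)] -/
theorem ineq5144_locAct_triple_chiRegime_false :
    ¬ (∀ (α I : Type) [Fintype α] [DecidableEq α] [Fintype I] [DecidableEq I] (blk : α → I) (Δ : Matrix α α ℝ) (ℱ : α → ℝ)
        (adj : I → I → Prop) [DecidableRel adj] (χ : CutoffProfile) (ι υ : Type) [Fintype ι] [DecidableEq ι] [Fintype υ] [DecidableEq υ]
        (p ek : ℝ) (B : Finset ι) (Φ : ι → (α → ℝ) → ℝ) (c : ι → ℝ) (Ys : Finset υ) (V : υ → (α → ℝ) → ℝ) (cube : ↥B ⊕ ↥Ys → I)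
        (n₀ : ℕ) (C : ℝ), 1 / 2 < p → 1 ≤ C →
        (∀ i, i ≤ n₀ → ∀ (A : ℝ) ⦃q e t : ℝ⦄, q ≠ 0 → 0 < e → 0 < t → t * e ≤ Real.exp (-1) →
          |iteratedDeriv i (fun s => cutoff χ (q * pLog p (s * e)) A) t| ≤ C * t ^ (-(i : ℤ))) →
        Δ.PosDef → ∀ (m : ℝ), 0 < m → (∀ φ : α → ℝ, m * (φ ⬝ᵥ φ) ≤ φ ⬝ᵥ (Δ *ᵥ φ)) → (∀ x, 0 ≤ χ.χ₁ x) →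
        ∀ (c₀ : ℝ), 0 < c₀ → (∀ b ∈ B, c₀ ≤ c b) → ∀ (Λ : ℝ), 0 < Λ →
        (∀ b ∈ B, ∃ ℓ₁ ℓ₂ : (α → ℝ) → ℝ, IsLinearMap ℝ ℓ₁ ∧ IsLinearMap ℝ ℓ₂ ∧
          ((∀ φ, Φ b φ = ℓ₁ φ) ∨ (∀ φ, Φ b φ = Real.sqrt (ℓ₁ φ ^ 2 + ℓ₂ φ ^ 2))) ∧
          (∀ φ, |ℓ₁ φ| ≤ Λ * Real.sqrt (φ ⬝ᵥ φ)) ∧ (∀ φ, |ℓ₂ φ| ≤ Λ * Real.sqrt (φ ⬝ᵥ φ))) →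
        ∀ (F : ℝ), 0 ≤ F → (∀ i : I, src blk ℱ {i} ⬝ᵥ src blk ℱ {i} ≤ F ^ 2) → (∀ Y ∈ Ys, Measurable (V Y)) →
        ∀ (KY : υ → ℝ), (∀ Y ∈ Ys, ∀ φ, |V Y φ| ≤ KY Y) → ∀ (K₁ : ℝ), 0 ≤ K₁ → (∀ Y ∈ Ys, KY Y ≤ K₁) →
        ∀ (G : ℕ), (∀ i, (univ.filter fun τ : ↥B ⊕ ↥Ys => cube τ = i).card ≤ G) → 0 < ek → ek ≤ Real.exp (-1) →
        ∀ (θ β' : ℝ), 0 < θ → θ ≤ 1 → 0 ≤ β' →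
        ((n₀ : ℝ) + 2 ≤ m / (8 * Λ ^ 2) * (81 / 100) * c₀ ^ 2 * Real.log ek⁻¹ ^ (2 * p - 1)) →
        (C ^ n₀ * (4 * Real.exp (F ^ 2 / m)) * Real.exp (2 * G * K₁) * ek ≤ 1) →
        (Real.exp (2 * G * K₁) * (2 * G) * (4 * Real.exp (F ^ 2 / m)) * ek + (Real.exp (2 * G * K₁) - 1) ≤ θ ^ (2 * β') / 2) →
        ek ≤ θ → 2 * ek ≤ θ ^ β' → (∀ Y ∈ Ys, KY Y * Real.exp (2 * G * K₁) ≤ θ ^ (1 + β') / 2) →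
        ∀ (Λc X : Finset I) (t : ℝ), t ∈ Set.Ioc (0 : ℝ) 1 → ∀ (L : Type) [Fintype L] [DecidableEq L], Fintype.card L ≤ n₀ →
        ∀ (γ : L → ↥(slotB B Ys cube X) ⊕ ↥(slotY B Ys cube X)) (H : Finset L) (X₃ : Finset I), X₃.card = 3 →
        |locAct (cubeIn cube X ∘ γ) (actIn blk Δ ℱ adj χ p ek B Φ c Ys V cube Λc X t γ) H X₃| ≤
          θ ^ ((H.card : ℝ) + β' * ((X₃ \ H.image (cubeIn cube X ∘ γ)).card : ℝ))) := by
  intro h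
  classical
  obtain ⟨C, hC1, hC⟩ := exists_const_all_orders gevreyCutoff 1 1
  obtain ⟨hΔ, hΔm⟩ := chain3_posDef_and_ge
  -- the constants
  have hC0 : 0 < C := by linarith
  set K : ℝ := 1 / 10 ^ 11 with hK
  set θ : ℝ := 1 / 10 ^ 5 with hθ
  set ek : ℝ := min (1 / 10 ^ 13) (1 / (16 * C)) with hekdef
  obtain ⟨hK0, hθ0, hθ1⟩ : 0 < K ∧ 0 < θ ∧ θ ≤ 1 := by rw [hK, hθ]; norm_num
  have hek0 : 0 < ek := lt_min (by norm_num) (by positivity)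
  have hek13 : ek ≤ 1 / 10 ^ 13 := min_le_left _ _; have hekC : ek ≤ 1 / (16 * C) := min_le_right _ _
  have he3 : Real.exp 1 < 3 := lt_trans Real.exp_one_lt_d9 (by norm_num)
  have hek1 : ek ≤ Real.exp (-1) := le_trans (by linarith) (show (1 : ℝ) / 3 ≤ Real.exp (-1) by
    rw [Real.exp_neg, inv_eq_one_div]; exact one_div_le_one_div_of_le (Real.exp_pos 1) he3.le)
  have heK : Real.exp (2 * ((1 : ℕ) : ℝ) * K) ≤ 3 := le_trans (Real.exp_le_exp.2 (by rw [hK]; norm_num)) he3.le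
  have heK' : Real.exp (2 * ((1 : ℕ) : ℝ) * K) - 1 ≤ 2 * K + (2 * K) ^ 2 := by
    have h2 := (abs_le.1 (Real.abs_exp_sub_one_sub_id_le (show |2 * K| ≤ 1 by rw [abs_of_pos (by positivity), hK]; norm_num))).2
    rw [show 2 * ((1 : ℕ) : ℝ) * K = 2 * K by simp]; linarith
  -- the datum: three cubes, no χ-slots, one interaction term on cube 0
  let cube₀ : ↥(∅ : Finset Unit) ⊕ ↥(univ : Finset Unit) → Fin 3 := fun _ => 0
  have hY0 : (⟨(), mem_univ _⟩ : ↥(univ : Finset Unit)) ∈ slotY (∅ : Finset Unit) (univ : Finset Unit) cube₀ (univ : Finset (Fin 3)) :=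
    mem_filter.2 ⟨mem_univ _, mem_univ _⟩
  let γ₀ : Unit → ↥(slotB (∅ : Finset Unit) (univ : Finset Unit) cube₀ (univ : Finset (Fin 3))) ⊕
      ↥(slotY (∅ : Finset Unit) (univ : Finset Unit) cube₀ (univ : Finset (Fin 3))) := fun _ => Sum.inr ⟨_, hY0⟩
  have hF : ∀ i : Fin 3, src (id : Fin 3 → Fin 3) (0 : Fin 3 → ℝ) {i} ⬝ᵥ src (id : Fin 3 → Fin 3) (0 : Fin 3 → ℝ) {i} ≤ (0 : ℝ) ^ 2 :=
    fun i => by simp [BIJ88PolymerRep5134Gauss.src, dotProduct]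
  have hVm : Measurable fun φ : Fin 3 → ℝ => K * Real.exp (-(φ 0) ^ 2) := Continuous.measurable (by fun_prop)
  have hVb : ∀ φ : Fin 3 → ℝ, |K * Real.exp (-(φ 0) ^ 2)| ≤ K := fun φ => by
    rw [abs_of_nonneg (by positivity)]
    exact mul_le_of_le_one_right hK0.le (Real.exp_le_one_iff.2 (neg_nonpos.2 (sq_nonneg _)))
  have hG : ∀ i : Fin 3, (univ.filter fun τ : ↥(∅ : Finset Unit) ⊕ ↥(univ : Finset Unit) => cube₀ τ = i).card ≤ 1 := fun i =>
    (card_le_univ _).trans (by simp)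
  -- the regime inequalities (`n₀ = 1`, `m = 1/2`, `Λ = 1`, `c₀ = 10`, `F = 0`, `G = 1`, `K₁ = K`, `β′ = 1`)
  have hreg₂ : (((1 : ℕ) : ℝ) + 2 ≤ (1 / 2) / (8 * (1 : ℝ) ^ 2) * (81 / 100) * (10 : ℝ) ^ 2 * Real.log ek⁻¹ ^ (2 * (1 : ℝ) - 1)) := by
    have hinv : (10 : ℝ) ^ 13 ≤ ek⁻¹ := by rw [le_inv_comm₀ (by positivity) hek0]; rw [one_div] at hek13; exact hek13
    have hlog : 1 ≤ Real.log ek⁻¹ := by rw [Real.le_log_iff_exp_le (inv_pos.2 hek0)]; linarith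
    rw [show (2 : ℝ) * 1 - 1 = 1 by norm_num, Real.rpow_one, Nat.cast_one]
    nlinarith
  have hpre₂ : C ^ 1 * (4 * Real.exp ((0 : ℝ) ^ 2 / (1 / 2))) * Real.exp (2 * ((1 : ℕ) : ℝ) * K) * ek ≤ 1 := by
    have h1 : C ^ 1 * (4 * Real.exp ((0 : ℝ) ^ 2 / (1 / 2))) * Real.exp (2 * ((1 : ℕ) : ℝ) * K) * ek ≤ C * 4 * 3 * (1 / (16 * C)) := by
      rw [pow_one, show Real.exp ((0 : ℝ) ^ 2 / (1 / 2)) = 1 by simp, mul_one]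
      gcongr
    have h2 : C * 4 * 3 * (1 / (16 * C)) = 3 / 4 := by field_simp; ring
    linarith
  have hvac₂ : Real.exp (2 * ((1 : ℕ) : ℝ) * K) * (2 * ((1 : ℕ) : ℝ)) * (4 * Real.exp ((0 : ℝ) ^ 2 / (1 / 2))) * ek +
      (Real.exp (2 * ((1 : ℕ) : ℝ) * K) - 1) ≤ θ ^ (2 * (1 : ℝ)) / 2 := by
    have h0 : Real.exp ((0 : ℝ) ^ 2 / (1 / 2)) = 1 := by simp
    rw [h0, mul_one, show (2 : ℝ) * 1 = (2 : ℕ) by norm_num, Real.rpow_natCast]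
    have h1 : Real.exp (2 * ((1 : ℕ) : ℝ) * K) * (2 * ((1 : ℕ) : ℝ)) * 4 * ek ≤ 3 * (2 * 1) * 4 * (1 / 10 ^ 13) := by gcongr; simp
    rw [hθ, hK] at *
    nlinarith
  have hekθ : ek ≤ θ := by rw [hθ]; linarith
  have hχβ : 2 * ek ≤ θ ^ (1 : ℝ) := by rw [Real.rpow_one, hθ]; linarith
  have hKθ₂ : ∀ Y ∈ (univ : Finset Unit), K * Real.exp (2 * ((1 : ℕ) : ℝ) * K) ≤ θ ^ ((1 : ℝ) + 1) / 2 := fun _ _ => by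
    rw [show (1 : ℝ) + 1 = (2 : ℕ) by norm_num, Real.rpow_natCast]
    calc K * Real.exp (2 * ((1 : ℕ) : ℝ) * K) ≤ K * 3 := by gcongr
      _ ≤ θ ^ 2 / 2 := by rw [hK, hθ]; norm_num
  -- the statement on the datum
  have hmain := h (Fin 3) (Fin 3) id (!![2, 1, 0; 1, 2, 1; 0, 1, 2]) 0 (fun x y => x ≠ y) gevreyCutoff Unit Unit 1 ek ∅ (fun _ _ => 0)
    (fun _ => 1) univ (fun _ φ => K * Real.exp (-(φ 0) ^ 2)) cube₀ 1 C (by norm_num) hC1 hC hΔ (1 / 2) (by norm_num) hΔm chi1_nonneg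
    10 (by norm_num) (fun b hb => absurd hb (notMem_empty _)) 1 one_pos (fun b hb => absurd hb (notMem_empty _)) 0 le_rfl hF
    (fun _ _ => hVm) (fun _ => K) (fun _ _ φ => hVb φ) K hK0.le (fun _ _ => le_rfl) 1 hG hek0 hek1 θ 1 hθ0 hθ1 zero_le_one hreg₂ hpre₂
    hvac₂ hekθ hχβ hKθ₂ univ univ 1 ⟨one_pos, le_rfl⟩ Unit (by simp) γ₀ univ univ (by simp)
  -- evaluate the located activity of the triple: the corner sum of the one differentiated slot under the eight region laws
  have hconn : IsConn (fun x y : Fin 3 => x ≠ y) (univ : Finset (Fin 3)) := by decide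
  have hT : (univ.filter fun τ : ↥(slotB (∅ : Finset Unit) (univ : Finset Unit) cube₀ (univ : Finset (Fin 3))) ⊕
      ↥(slotY (∅ : Finset Unit) (univ : Finset Unit) cube₀ (univ : Finset (Fin 3))) =>
        cubeIn cube₀ (univ : Finset (Fin 3)) τ ∈ (univ : Finset (Fin 3))) = {Sum.inr ⟨_, hY0⟩} := by
    ext τ
    simp only [mem_filter, mem_univ, true_and, mem_singleton]
    refine ⟨fun _ => ?_, fun _ => trivial⟩
    rcases τ with ⟨⟨b, hb⟩, _⟩ | ⟨⟨u, hu⟩, hY⟩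
    · exact absurd hb (notMem_empty _)
    · rfl
  have hcard : (univ.filter fun l : Unit => γ₀ l = Sum.inr ⟨_, hY0⟩).card = 1 := by
    rw [filter_true_of_mem fun l _ => rfl, card_univ, Fintype.card_unit]
  have hext : ∀ ω : BIJ88PolymerRep5134Gauss.Site (id : Fin 3 → Fin 3) (univ : Finset (Fin 3)) → ℝ,
      ext (id : Fin 3 → Fin 3) (univ : Finset (Fin 3)) ω 0 = ω ⟨0, mem_univ _⟩ := fun ω => by simp [BIJ88PolymerRep5134Gauss.ext]
  have hderiv : ∀ a : ℝ, deriv (fun s : ℝ => Real.exp (-(s * a))) 1 = -(a * Real.exp (-a)) := fun a => by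
    have hd : HasDerivAt (fun s : ℝ => Real.exp (-(s * a))) (Real.exp (-(1 * a)) * (-(1 * a))) 1 :=
      (((hasDerivAt_id (1 : ℝ)).mul_const a).neg).exp
    rw [hd.deriv]; ring_nf
  have h3univ : (univ : Finset (Fin 3)) = {0, 1, 2} := by decide
  rw [locAct_of_loc (fun j _ => mem_univ _), actIn_eq_cornerSum _ _ _ _ _ _ _ _ _ _ _ _ _ _ _ _ _ _ (by simp), if_pos hconn] at hmain
  simp only [hT, prod_singleton, hcard, slotFactor_inr, iteratedDeriv_one, hderiv, hext, interpForm_id_corner_univ] at hmain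
  have hcs : ∀ Fc : Finset (Fin 3) → ℝ, cornerSum Fc univ = Fc univ - Fc {0, 1} - Fc {0, 2} - Fc {1, 2} + Fc {0} + Fc {1} + Fc {2} - Fc ∅ :=
    fun Fc => by rw [h3univ]; exact cornerSum_triple Fc (show (0 : Fin 3) ≠ 1 by decide) (show (0 : Fin 3) ≠ 2 by decide) (show (1 : Fin 3) ≠ 2 by decide)
  rw [hcs] at hmain
  -- the observable `v = e^{−φ₀²}` and the eight Gaussian values
  obtain ⟨v, hv⟩ : ∃ v : (BIJ88PolymerRep5134Gauss.Site (id : Fin 3 → Fin 3) (univ : Finset (Fin 3)) → ℝ) → ℝ,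
    v = fun ω => Real.exp (-(ω ⟨0, mem_univ _⟩) ^ 2) := ⟨_, rfl⟩
  have hvfold : ∀ ω : BIJ88PolymerRep5134Gauss.Site (id : Fin 3 → Fin 3) (univ : Finset (Fin 3)) → ℝ,
    Real.exp (-(ω ⟨0, mem_univ _⟩) ^ 2) = v ω := fun ω => by rw [hv]
  simp only [hvfold] at hmain
  haveI hP : ∀ Λ', IsProbabilityMeasure (regionLaw (id : Fin 3 → Fin 3) (!![2, 1, 0; 1, 2, 1; 0, 1, 2] : Matrix (Fin 3) (Fin 3) ℝ)
      (0 : Fin 3 → ℝ) (univ : Finset (Fin 3)) Λ') := fun Λ' => isProbabilityMeasure_regionLaw _ _ _ hΔ _ Λ'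
  have hvm : Measurable v := by rw [hv]; fun_prop
  have hv0 : ∀ ω, 0 < v ω := fun ω => by rw [hv]; exact Real.exp_pos _
  have hv1 : ∀ ω, v ω ≤ 1 := fun ω => by rw [hv]; exact Real.exp_le_one_iff.2 (neg_nonpos.2 (sq_nonneg _))
  have hJ := fun Λ' => integral_neg_mul_exp_neg_window (regionLaw (id : Fin 3 → Fin 3) (!![2, 1, 0; 1, 2, 1; 0, 1, 2] : Matrix (Fin 3) (Fin 3) ℝ)
      (0 : Fin 3 → ℝ) (univ : Finset (Fin 3)) Λ') hvm hv0 hv1 hK0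
  have hI := fun Λ' => integral_exp_neg_sq_regionLaw3 Λ'
  simp only [hvfold] at hI
  obtain ⟨c1, c2, c3, c4⟩ := interpForm_chain3_corners
  obtain ⟨d1, d2, d3, d4, d5, d6, d7, d8⟩ := chain3_dets
  obtain ⟨w1, w2, w3, w4, w5⟩ := sqrt_windows3
  -- the eight windows
  have r123 : ∫ ω, v ω ∂(regionLaw (id : Fin 3 → Fin 3) (!![2, 1, 0; 1, 2, 1; 0, 1, 2] : Matrix (Fin 3) (Fin 3) ℝ) (0 : Fin 3 → ℝ) univ univ) =
      Real.sqrt 4 / Real.sqrt 10 := by rw [hI, c1, d1, d2]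
  have r01 : ∫ ω, v ω ∂(regionLaw (id : Fin 3 → Fin 3) (!![2, 1, 0; 1, 2, 1; 0, 1, 2] : Matrix (Fin 3) (Fin 3) ℝ) (0 : Fin 3 → ℝ) univ {0, 1}) =
      Real.sqrt 6 / Real.sqrt 14 := by rw [hI, c2, d3, d4]
  have r12 : ∫ ω, v ω ∂(regionLaw (id : Fin 3 → Fin 3) (!![2, 1, 0; 1, 2, 1; 0, 1, 2] : Matrix (Fin 3) (Fin 3) ℝ) (0 : Fin 3 → ℝ) univ {1, 2}) =
      Real.sqrt 6 / Real.sqrt 12 := by rw [hI, c3, d5, d6]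
  have rdec : ∀ Λ' ∈ ({{0, 2}, {0}, {1}, {2}, ∅} : Finset (Finset (Fin 3))),
      ∫ ω, v ω ∂(regionLaw (id : Fin 3 → Fin 3) (!![2, 1, 0; 1, 2, 1; 0, 1, 2] : Matrix (Fin 3) (Fin 3) ℝ) (0 : Fin 3 → ℝ) univ Λ') =
        Real.sqrt 8 / Real.sqrt 16 := fun Λ' hΛ' => by rw [hI, c4 Λ' hΛ', d7, d8]
  have r02 := rdec {0, 2} (by simp)
  have r0 := rdec {0} (by simp)
  have r1 := rdec {1} (by simp)
  have r2 := rdec {2} (by simp)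
  have r_e := rdec ∅ (by simp)
  obtain ⟨l123, -⟩ := hJ univ
  obtain ⟨-, u01⟩ := hJ {0, 1}
  obtain ⟨-, u02⟩ := hJ {0, 2}
  obtain ⟨-, u12⟩ := hJ {1, 2}
  obtain ⟨l0, -⟩ := hJ {0}
  obtain ⟨l1, -⟩ := hJ {1}
  obtain ⟨l2, -⟩ := hJ {2}
  obtain ⟨-, u_e⟩ := hJ ∅
  rw [r123] at l123; rw [r01] at u01; rw [r02] at u02; rw [r12] at u12; rw [r0] at l0; rw [r1] at l1; rw [r2] at l2; rw [r_e] at u_e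
  -- the located exponent is `3`
  have himg : (univ : Finset Unit).image (cubeIn cube₀ (univ : Finset (Fin 3)) ∘ γ₀) = {0} := by
    ext z
    simp only [mem_image, mem_univ, true_and, mem_singleton, Function.comp_apply]
    exact ⟨fun ⟨_, hz⟩ => hz.symm, fun hz => ⟨(), hz.symm⟩⟩
  have hsd : ((((univ : Finset (Fin 3))) \ {0}).card : ℝ) = 2 := by
    rw [show ((univ : Finset (Fin 3)) \ {0}) = {1, 2} by decide]; rfl
  rw [himg, hsd, card_univ, Fintype.card_unit, Nat.cast_one] at hmain
  have hθpow : θ ^ ((1 : ℝ) + 1 * 2) = 1 / 10 ^ 15 := by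
    rw [show (1 : ℝ) + 1 * 2 = (3 : ℕ) by norm_num, Real.rpow_natCast, hθ]; norm_num
  rw [hθpow] at hmain
  have heK1 : 1 - K ≤ Real.exp (-K) := by linarith [Real.add_one_le_exp (-K)]
  have hact := (abs_le.1 hmain).2
  -- products with `e^{−K}`: lower bounds
  have p01 : (6546 : ℝ) / 10000 * (1 - K) ≤ Real.sqrt 6 / Real.sqrt 14 * Real.exp (-K) :=
    mul_le_mul w2 heK1 (by rw [hK]; norm_num) (le_trans (by norm_num) w2)
  have p12 : (7071 : ℝ) / 10000 * (1 - K) ≤ Real.sqrt 6 / Real.sqrt 12 * Real.exp (-K) :=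
    mul_le_mul w3 heK1 (by rw [hK]; norm_num) (le_trans (by norm_num) w3)
  have pdec : (7071 : ℝ) / 10000 * (1 - K) ≤ Real.sqrt 8 / Real.sqrt 16 * Real.exp (-K) :=
    mul_le_mul w4 heK1 (by rw [hK]; norm_num) (le_trans (by norm_num) w4)
  rw [hK] at hact l123 u01 u02 u12 l0 l1 l2 u_e p01 p12 pdec
  linarith [w1, w5]

end Main

end Literature.MathematicalPhysics.QuantumFieldTheory.BalabanImbrieJaffe1984to88.BIJ88Ineq5144TripleDecayWitness

end
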